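import Summits.Ventures.DiscreteObjects.STD.NoOrderSeven

/-!
# STD₂[12;6]: an automorphism of order 11 fixes exactly one point class and one block class, both elementwise (kernel; Z11 shape) + prime-order atlas
Framing: lottery ticket; floor = certified bounds/negative ranges.

Cell pub-namedobj (target M), STD₂[12;6] automorphism census. Designs g4/g5's normal form for the cell Z11 (FAMILY-INV2 §6,
FAMILY-ZCOVER §9: 'classes {∞} ∪ Z₁₁ on both sides, π_{∞j} = π_{i∞} = id up to relabelling') rests on the reduction proved here
in the incidence-array vocabulary of `OrderFiveReduction`: an array automorphism of an STD₂[12;6] with `σ¹¹ = ρ¹¹ = 1`, eleventh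
powers of the label maps trivial on fixed classes, and not the identity on points, fixes EXACTLY ONE point class and EXACTLY ONE
block class, and acts trivially on the labels of both (`order_eleven_reduction`). Ingredients: `fixedCard ≡ card (mod 11)` forces
1 or 12 fixed classes and all 6 labels fixed; twelve blockwise-fixed block classes together with a moved point class contradict
λ = 2 (`no_identity_type_prime`, p = 11). The Z11 search itself (no such STD exists; designs g5, two-engine, verify-ref g53) is NOT
formalised.
-/

namespace Summit.Ventures.DiscreteObjects.STD

open Finset Equiv Summit.Ventures.DiscreteObjects.PP12

section PermFacts

/-- A permutation of `Fin 6` whose eleventh power is `1` is the identity. -/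
theorem eq_one_of_pow_eleven_six {α : Perm (Fin 6)} (hα : α ^ 11 = 1) : α = 1 := by
  haveI : Fact (Nat.Prime 11) := ⟨by norm_num⟩
  have h1 := fixedCard_modEq hα
  have h2 := fixedCard_le α
  simp only [Fintype.card_fin] at h1
  unfold Nat.ModEq at h1
  exact eq_one_of_fixedCard_eq α (by omega)

/-- A permutation of `Fin 12` whose eleventh power is `1` fixes 1 or 12 points. -/
theorem fixedCard_twelve_of_pow_eleven {σ : Perm (Fin 12)} (hσ : σ ^ 11 = 1) :
    fixedCard σ = 1 ∨ fixedCard σ = 12 := by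
  haveI : Fact (Nat.Prime 11) := ⟨by norm_num⟩
  have h1 := fixedCard_modEq hσ
  have h2 := fixedCard_le σ
  simp only [Fintype.card_fin] at h1
  unfold Nat.ModEq at h1
  omega

end PermFacts

section STD

variable (π : IncArray 12 6) (τ : ArrayAut π)

/-- **Order-11 reduction (shape of the Z11 cell).** An array automorphism of an STD₂[12;6] with `σ¹¹ = 1`, `ρ¹¹ = 1`,
`(α i)¹¹ = 1` on fixed point classes, `(β j)¹¹ = 1` on fixed block classes, not the identity on points, fixes exactly one
point class and exactly one block class, and its label maps on these two classes are the identity. -/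
theorem order_eleven_reduction (hπ : IsSTD 2 π) (hσ : τ.σ ^ 11 = 1) (hρ : τ.ρ ^ 11 = 1)
    (hα : ∀ i, τ.σ i = i → τ.α i ^ 11 = 1) (hβ : ∀ j, τ.ρ j = j → τ.β j ^ 11 = 1)
    (hne : ¬ (τ.σ = 1 ∧ ∀ i, τ.α i = 1)) :
    fixedCard τ.σ = 1 ∧ fixedCard τ.ρ = 1 ∧
      (∀ i, τ.σ i = i → τ.α i = 1) ∧ (∀ j, τ.ρ j = j → τ.β j = 1) := by
  have hαid : ∀ i, τ.σ i = i → τ.α i = 1 := fun i h => eq_one_of_pow_eleven_six (hα i h)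
  have hβid : ∀ j, τ.ρ j = j → τ.β j = 1 := fun j h => eq_one_of_pow_eleven_six (hβ j h)
  -- σ ≠ 1: otherwise every class is fixed and every label map is the identity
  have hmoved : ∃ i, τ.σ i ≠ i := by
    by_contra h
    push Not at h
    exact hne ⟨Equiv.ext h, fun i => hαid i (h i)⟩
  obtain ⟨i₀, hi₀⟩ := hmoved
  have hP : fixedCard τ.σ = 1 := by
    rcases fixedCard_twelve_of_pow_eleven hσ with h | h
    · exact h
    · exfalso
      have hs := eq_one_of_fixedCard_eq _ h
      exact hi₀ (by rw [hs]; rfl)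
  have hB : fixedCard τ.ρ = 1 := by
    rcases fixedCard_twelve_of_pow_eleven hρ with h | h
    · exact h
    · exfalso
      obtain ⟨j₁, j₂, hj, hj₁, hj₂⟩ := two_fixed_of_le (τ := τ.ρ) (by omega)
      exact no_identity_type_prime π τ hπ (by norm_num) (by norm_num) hσ hj hj₁ hj₂ (hβid j₁ hj₁) (hβid j₂ hj₂) hi₀
  exact ⟨hP, hB, hαid, hβid⟩

/-- **Prime-order atlas of Aut(STD₂[12;6]) (kernel part).** If an array automorphism of an STD₂[12;6] satisfies `σᵖ = ρᵖ = 1`,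
`(α i)ᵖ = 1` on fixed point classes and `(β j)ᵖ = 1` on fixed block classes for a prime `p`, and is not the identity on points,
then `p ∈ {2, 3, 5, 11}` (`p = 7`: `no_order_seven`; `p ≥ 13`: `no_order_prime_ge_thirteen`). The census then decides 11
(Z11, designs g5) and 5 (P5, designs g6) by exhaustive search: both empty. -/
theorem prime_order_atlas (hπ : IsSTD 2 π) {p : ℕ} (hp : p.Prime) (hσ : τ.σ ^ p = 1) (hρ : τ.ρ ^ p = 1)
    (hα : ∀ i, τ.σ i = i → τ.α i ^ p = 1) (hβ : ∀ j, τ.ρ j = j → τ.β j ^ p = 1)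
    (hne : ¬ (τ.σ = 1 ∧ ∀ i, τ.α i = 1)) : p = 2 ∨ p = 3 ∨ p = 5 ∨ p = 11 := by
  by_cases h13 : 13 ≤ p
  · exact (hne (no_order_prime_ge_thirteen π τ hp h13 hσ hα)).elim
  · have hp2 := hp.two_le
    interval_cases p
    · exact Or.inl rfl
    · exact Or.inr (Or.inl rfl)
    · exact absurd hp (by norm_num)
    · exact Or.inr (Or.inr (Or.inl rfl))
    · exact absurd hp (by norm_num)
    · exact (hne (no_order_seven π τ hπ hσ hρ hβ)).elim
    · exact absurd hp (by norm_num)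
    · exact absurd hp (by norm_num)
    · exact absurd hp (by norm_num)
    · exact Or.inr (Or.inr (Or.inr rfl))
    · exact absurd hp (by norm_num)

end STD

end Summit.Ventures.DiscreteObjects.STD
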